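import Summits.ABC.StewartYu.PrimePadicSocketLog
import HarnessLib

/-!
# Cell abc-stewartyu: the prime-argument `p`-adic SOCKET of the abc assembly, III —
# one member of the triple against the radical, general exponents

`Summits/ABC/StewartYu/PrimePadicSocketRad.lean` — sequel to
`PrimePadicSocketLog.lean` (theorems only: no definition, no named fact).
The book-keeping of the general socket: for a `p`-adic bound at prime arguments of the shape
`K Lⁿ n^{κn} p^σ (∏ log qᵢ) (log max(3, max|eᵢ|) + log p + ∑ log qᵢ)^{τ₀ + τ₁ n}` (`κ, σ ≥ 0`
real, `τ₀, τ₁ ∈ ℕ`), applied at the primes `p ≥ p₀` of a member `x` of a triple with cofactors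
`y, z` (`x ∣ y² − z²`), the sum `∑_{p ∣ x, p ≥ p₀} ord_p(x) log p` is at most
`M · rad(xyz)^{κ+σ+3τ₁+5/8} · max(3, 3 log max(y,z))^δ · (log max(3, log max(y,z)))^{τ₀}`
(`sum_padicPart_le_rad_general`), for every `δ > 0`, with `M = 48 K A e^{τ₁} (16(τ₀+1))^{τ₀}` and
`A` the constant absorbing `(4 L e^κ ((τ₁+1)/δ)^{τ₁})^{ω(yz)}` against `rad(yz)^{1/8}`
(`exists_pow_card_le_prod_rpow`). Book-keeping, with `Q = rad(yz) ≥ n!`, `n = ω(yz)`,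
`R = rad(xyz)`: `n^{κn} ≤ e^{κn} Q^κ`, `∏ log q ≤ 4ⁿ Q^{1/4}`, `∑_{p∣x} p^σ log p ≤ 8 rad(x)^{σ+1/8}`,
`log p + ∑ log qᵢ ≤ log R`, `(W + log R)^N ≤ W^N (1 + log R)^N` (`W ≥ 1`),
`(1 + log R)ⁿ ≤ n! · eR`, `Wⁿ ≤ ε^{-n} n! e^{εW}` (`ε = δ/(τ₁+1)`),
`(1 + log R)^{τ₀} ≤ (8(τ₀+1))^{τ₀} · 2R^{1/8}` (`logFactor_le`, `one_add_log_pow_mul_le`,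
`one_add_log_pow_le`, `log_pow_mul_le`, `rpow_collect`, `powers_le_rpow`).

Nothing here is claimed to be in print beyond the summation pattern of Stewart–Tijdeman 1986
[cite: ShoreyTijdeman1986, Ch. 1, proof of Theorem 1.2 (PDF p. 48)].

## References

* [StewartTijdeman1986] C. L. Stewart, R. Tijdeman, *On the Oesterlé–Masser conjecture*, Monatsh.
  Math. 102 (1986), 251–257 — Theorem 1, as quoted in [Waldschmidt2014] §2.
* [ShoreyTijdeman1986] T. N. Shorey, R. Tijdeman, *Exponential Diophantine Equations*, Cambridge
  Tracts in Math. 87, CUP 1986 — Ch. 1, Theorem 1.2 and its proof.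
-/


noncomputable section

open Finset Real
open Literature.NumberTheory.DiophantineGeometry

namespace Summit.ABC.StewartYu

open Literature.Barriers.ABC Literature.Barriers.ABC.StewartTijdemanGeneric

/-! ### One member of the triple against the radical, general exponents -/

/-- **The bound for one member, against the radical — general socket.** Hypothesis `hP`: for every
prime `p ≥ p₀`, all distinct primes `q₁, …, qₙ ≠ p` and all `e ∈ ℤⁿ ∖ {0}` with `∏ qᵢ^{eᵢ} ≠ 1`,
`ord_p(∏ qᵢ^{eᵢ} − 1) ≤ K Lⁿ n^{κn} p^σ (∏ log qᵢ) (log max(3, max|eᵢ|) + log p + ∑ log qᵢ)^{τ₀ + τ₁ n}`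
(`K ≥ 0`, `L ≥ 1`, `κ, σ ≥ 0`, `τ₀, τ₁ ∈ ℕ`). Then for coprime positive `y ≠ z` and `x > 0` coprime to
`yz` with `x ∣ y² − z²`, writing `R = rad(xyz)`, `Y₃ = max(3, 3 log max(y,z))`:
`∑_{p ∣ x, p ≥ p₀} ord_p(x) log p ≤ 48 K A e^{τ₁} (16(τ₀+1))^{τ₀} · R^{κ+σ+3τ₁+5/8} · Y₃^δ · (log max(3, log max(y,z)))^{τ₀}`,
for any `δ > 0` and any `A ≥ 0` with `(4 L e^κ ((τ₁+1)/δ)^{τ₁})^{#S} ≤ A (∏ S)^{1/8}` for all finite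
sets of primes `S` (`exists_pow_card_le_prod_rpow`). Book-keeping (with `Q = rad(yz) ≥ n!`,
`n = ω(yz)`): `n^{κn} ≤ e^{κn} Q^κ`, `∏ log q ≤ 4ⁿ Q^{1/4}`, `∑_{p∣x} p^σ log p ≤ 8 rad(x)^{σ+1/8}`,
`log p + ∑ log qᵢ ≤ log R`, and `logFactor_le`. [folklore] -/
theorem sum_padicPart_le_rad_general {K L κ σ δ A : ℝ} {τ₀ τ₁ p₀ : ℕ} (hK : 0 ≤ K) (hL : 1 ≤ L)
    (hκ0 : 0 ≤ κ) (hσ0 : 0 ≤ σ) (hδ : 0 < δ)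
    (hP : ∀ (p n : ℕ) (q : Fin n → ℕ) (e : Fin n → ℤ), p.Prime → p₀ ≤ p →
      (∀ i, (q i).Prime) → Function.Injective q → (∀ i, q i ≠ p) → e ≠ 0 →
      ∏ i, ((q i : ℚ)) ^ e i ≠ 1 →
      (padicValRat p (∏ i, ((q i : ℚ)) ^ e i - 1) : ℝ) ≤
        K * L ^ n * (n : ℝ) ^ (κ * n) * (p : ℝ) ^ σ * (∏ i, Real.log (q i)) *
          (Real.log (max 3 ((Finset.univ.sup fun i => (e i).natAbs : ℕ) : ℝ)) + Real.log p +
            ∑ i, Real.log (q i)) ^ (τ₀ + τ₁ * n))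
    (hA0 : 0 ≤ A)
    (hA : ∀ S : Finset ℕ, (∀ q ∈ S, q.Prime) →
      (4 * L * Real.exp κ * (((τ₁ : ℝ) + 1) / δ) ^ τ₁) ^ S.card ≤
        A * (((∏ q ∈ S, q : ℕ)) : ℝ) ^ (1 / 8 : ℝ))
    {x y z : ℕ} (hx : 0 < x) (hy : 0 < y) (hz : 0 < z) (hyz : y ≠ z) (hcop : Nat.Coprime y z)
    (hxcop : Nat.Coprime x (y * z)) (hdvd : (x : ℤ) ∣ (y : ℤ) ^ 2 - (z : ℤ) ^ 2) :
    ∑ p ∈ x.primeFactors.filter (fun p => p₀ ≤ p), (x.factorization p : ℝ) * Real.log p ≤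
      48 * K * A * Real.exp τ₁ * (16 * ((τ₀ : ℝ) + 1)) ^ τ₀ *
        (((∏ q ∈ (x * (y * z)).primeFactors, q : ℕ)) : ℝ) ^ (κ + σ + 3 * τ₁ + 5 / 8 : ℝ) *
        (max 3 (3 * Real.log (max y z : ℕ))) ^ δ *
        Real.log (max 3 (Real.log (max y z : ℕ))) ^ τ₀ := by
  classical
  have hx0 : x ≠ 0 := hx.ne'
  have hy0 : y ≠ 0 := hy.ne'
  have hz0 : z ≠ 0 := hz.ne'
  set S := (y * z).primeFactors with hS
  set n := S.card with hn
  set T := x.primeFactors.filter (fun p => p₀ ≤ p) with hT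
  set Q : ℝ := (((∏ q ∈ S, q : ℕ)) : ℝ) with hQ
  set Px : ℝ := (((∏ p ∈ x.primeFactors, p : ℕ)) : ℝ) with hPx
  set P₂ : ℝ := (((∏ p ∈ T, p : ℕ)) : ℝ) with hP₂
  set R : ℝ := (((∏ q ∈ (x * (y * z)).primeFactors, q : ℕ)) : ℝ) with hR
  set Θ : ℝ := ∏ q ∈ S, Real.log q with hΘ
  set Y₃ : ℝ := max 3 (3 * Real.log (max y z : ℕ)) with hY₃
  set W₃ : ℝ := Real.log Y₃ with hW₃
  set W : ℝ := Real.log (max 3 (Real.log (max y z : ℕ))) with hW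
  set N : ℕ := τ₀ + τ₁ * n with hN
  set Sg : ℝ := ∑ p ∈ T, (p : ℝ) ^ σ * Real.log p with hSg
  have hprimeS : ∀ q ∈ S, q.Prime := fun q hq => Nat.prime_of_mem_primeFactors hq
  have hprimeX : ∀ p ∈ x.primeFactors, p.Prime := fun p hp => Nat.prime_of_mem_primeFactors hp
  have hprimeT : ∀ p ∈ T, p.Prime := fun p hp => hprimeX p (Finset.mem_filter.mp hp).1
  have hQ1 : 1 ≤ Q := by
    rw [hQ]; exact_mod_cast Finset.prod_pos fun q hq => (hprimeS q hq).pos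
  have hPx1 : 1 ≤ Px := by
    rw [hPx]; exact_mod_cast Finset.prod_pos fun p hp => (hprimeX p hp).pos
  have hP₂1 : 1 ≤ P₂ := by
    rw [hP₂]; exact_mod_cast Finset.prod_pos fun p hp => (hprimeT p hp).pos
  have hP₂x : P₂ ≤ Px := by
    rw [hP₂, hPx]
    exact_mod_cast Finset.prod_le_prod_of_subset_of_one_le' (Finset.filter_subset _ _)
      fun p hp _ => (hprimeX p hp).one_lt.le
  -- the radical of `xyz`
  have hRad : R = Px * Q := by
    rw [hR, hPx, hQ, hS, Nat.Coprime.primeFactors_mul hxcop,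
      Finset.prod_union hxcop.disjoint_primeFactors]
    push_cast; ring
  have hQ0 : 0 < Q := by linarith
  have hPx0 : 0 < Px := by linarith
  have hP₂0 : 0 < P₂ := by linarith
  have hR1 : 1 ≤ R := by rw [hRad]; exact one_le_mul_of_one_le_of_one_le hPx1 hQ1
  have hR0 : 0 < R := by linarith
  have hQR : Q ≤ R := by rw [hRad]; exact le_mul_of_one_le_left hQ0.le hPx1
  have hPxR : Px ≤ R := by rw [hRad]; exact le_mul_of_one_le_right hPx0.le hQ1
  have hlogR0 : 0 ≤ Real.log R := Real.log_nonneg hR1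
  -- `Y₃ ≥ 3`, `W₃ ≥ 1`, `W ≥ 1`
  have hY₃3 : (3 : ℝ) ≤ Y₃ := le_max_left _ _
  have hY₃1 : (1 : ℝ) ≤ Y₃ := le_trans (by norm_num) hY₃3
  have hY₃0 : 0 < Y₃ := by linarith
  have hl3 : 1 ≤ Real.log 3 := by
    rw [Real.le_log_iff_exp_le (by norm_num)]
    exact Real.exp_one_lt_d9.le.trans (by norm_num)
  have hW₃1 : 1 ≤ W₃ := hl3.trans (Real.log_le_log (by norm_num) hY₃3)
  have hW₃0 : 0 ≤ W₃ := zero_le_one.trans hW₃1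
  have hW1 : 1 ≤ W := hl3.trans (Real.log_le_log (by norm_num) (le_max_left _ _))
  have hW0 : 0 ≤ W := zero_le_one.trans hW1
  have hW₃W : W₃ ≤ 2 * W := by rw [hW₃, hY₃, hW]; exact log_max_three_mul_le _
  have hΘ0 : 0 ≤ Θ := Finset.prod_nonneg fun q hq =>
    Real.log_nonneg (by exact_mod_cast (hprimeS q hq).one_lt.le)
  have hL0 : 0 ≤ L := zero_le_one.trans hL
  -- Step 1: the localized summation with `F p = K Lⁿ n^{κn} p^σ Θ (W₃ + log R)^N`
  have hsum := sum_padicPart_le_of_local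
    (fun p => K * L ^ n * (n : ℝ) ^ (κ * n) * (p : ℝ) ^ σ * Θ * (W₃ + Real.log R) ^ N)
    (p₀ := p₀) hx hy hz hyz hcop hxcop hdvd ?_
  swap
  · intro p q e hpP hp₀ hpdx hqP hinj himg hqp hene hne1 hB
    have key := hP p n q e hpP hp₀ hqP hinj hqp hene hne1
    -- `∏ log qᵢ = Θ`, `∑ log qᵢ = log Q`
    have hprodq : ∏ i, Real.log (q i) = Θ := by
      have h := Finset.prod_image (f := fun r : ℕ => Real.log (r : ℝ)) (s := Finset.univ)
        (g := q) (fun i _ j _ h => hinj h)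
      rw [himg] at h
      rw [hΘ, h]
    have hsumq : ∑ i, Real.log (q i) = Real.log Q := by
      have h := Finset.sum_image (f := fun r : ℕ => Real.log (r : ℝ)) (s := Finset.univ)
        (g := q) (fun i _ j _ h => hinj h)
      rw [himg] at h
      rw [hQ, Nat.cast_prod, Real.log_prod (s := S) (fun r hr => ?_), h]
      exact_mod_cast (hprimeS r hr).ne_zero
    -- `p · Q ≤ R`
    have hpx : p ∈ x.primeFactors := Nat.mem_primeFactors.mpr ⟨hpP, hpdx, hx0⟩
    have hpPx : (p : ℝ) ≤ Px := by
      rw [hPx]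
      exact_mod_cast Nat.le_of_dvd (Finset.prod_pos fun p hp => (hprimeX p hp).pos)
        (Finset.dvd_prod_of_mem _ hpx)
    have hp0 : (0 : ℝ) < p := by exact_mod_cast hpP.pos
    have hlogpQ : Real.log p + Real.log Q ≤ Real.log R := by
      rw [← Real.log_mul hp0.ne' hQ0.ne', hRad]
      exact Real.log_le_log (mul_pos hp0 hQ0) (mul_le_mul_of_nonneg_right hpPx hQ0.le)
    -- the logarithmic factor
    have hsup3 : Real.log (max 3 (((Finset.univ.sup fun i => (e i).natAbs : ℕ)) : ℝ)) ≤ W₃ := by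
      rw [hW₃, hY₃]
      exact Real.log_le_log (lt_of_lt_of_le (by norm_num) (le_max_left _ _))
        (max_le_max le_rfl hB)
    have h1 : 0 ≤ Real.log (max 3 (((Finset.univ.sup fun i => (e i).natAbs : ℕ)) : ℝ)) :=
      Real.log_nonneg (le_trans (by norm_num) (le_max_left _ _))
    have h2 : 0 ≤ Real.log p := Real.log_nonneg (by exact_mod_cast hpP.one_lt.le)
    have h3 : 0 ≤ ∑ i, Real.log (q i) := Finset.sum_nonneg fun i _ =>
      Real.log_nonneg (by exact_mod_cast (hqP i).one_lt.le)
    have hbase0 : 0 ≤ Real.log (max 3 (((Finset.univ.sup fun i => (e i).natAbs : ℕ)) : ℝ)) +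
        Real.log p + ∑ i, Real.log (q i) := by linarith
    have hbase : Real.log (max 3 (((Finset.univ.sup fun i => (e i).natAbs : ℕ)) : ℝ)) +
        Real.log p + ∑ i, Real.log (q i) ≤ W₃ + Real.log R := by
      rw [hsumq]; linarith
    have hpowN : (Real.log (max 3 (((Finset.univ.sup fun i => (e i).natAbs : ℕ)) : ℝ)) +
        Real.log p + ∑ i, Real.log (q i)) ^ N ≤ (W₃ + Real.log R) ^ N :=
      pow_le_pow_left₀ hbase0 hbase N
    have hpre : 0 ≤ K * L ^ n * (n : ℝ) ^ (κ * n) * (p : ℝ) ^ σ * Θ := by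
      have : 0 ≤ L ^ n := pow_nonneg hL0 n
      positivity
    rw [hprodq] at key
    exact key.trans (mul_le_mul_of_nonneg_left hpowN hpre)
  -- Step 2: pull the `p`-independent factor out of the sum
  have hsum' : ∑ p ∈ T, (x.factorization p : ℝ) * Real.log p ≤
      K * L ^ n * (n : ℝ) ^ (κ * n) * Θ * (W₃ + Real.log R) ^ N * Sg := by
    refine hsum.trans (le_of_eq ?_)
    rw [hSg, Finset.mul_sum]
    exact Finset.sum_congr rfl fun p _ => by ring
  -- Step 3: the book-keeping
  have hfact : ((n.factorial : ℕ) : ℝ) ≤ Q := by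
    rw [hQ]
    exact_mod_cast factorial_card_le_prod n S hn.symm fun q hq => (hprimeS q hq).one_lt.le
  have h1 : (n : ℝ) ^ (κ * n) ≤ Real.exp κ ^ n * Q ^ κ :=
    (rpow_mul_self_le hκ0 n).trans
      (mul_le_mul_of_nonneg_left (Real.rpow_le_rpow (Nat.cast_nonneg _) hfact hκ0)
        (pow_nonneg (Real.exp_pos κ).le n))
  have h2 : Θ ≤ 4 ^ n * Q ^ (1 / 4 : ℝ) := by
    have h := prod_log_le_pow_mul_prod_rpow hprimeS (θ := 1 / 4) (by norm_num)
    rw [one_div_one_div] at h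
    exact h
  have h3 : Sg ≤ 8 * (P₂ ^ σ * P₂ ^ (1 / 8 : ℝ)) := by
    have h := sum_rpow_mul_log_le hprimeT hσ0
    have hlog : Real.log P₂ ≤ P₂ ^ (1 / 8 : ℝ) / (1 / 8) :=
      Real.log_le_rpow_div (zero_le_one.trans hP₂1) (by norm_num)
    calc Sg ≤ P₂ ^ σ * Real.log P₂ := h
      _ ≤ P₂ ^ σ * (P₂ ^ (1 / 8 : ℝ) / (1 / 8)) :=
          mul_le_mul_of_nonneg_left hlog (Real.rpow_nonneg (zero_le_one.trans hP₂1) σ)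
      _ = 8 * (P₂ ^ σ * P₂ ^ (1 / 8 : ℝ)) := by ring
  have h4 := logFactor_le (τ₀ := τ₀) (τ₁ := τ₁) (W := W) hR1 hY₃1 hW₃1 hW₃W hfact hδ
  have h5 : (4 * L * Real.exp κ * (((τ₁ : ℝ) + 1) / δ) ^ τ₁) ^ n ≤ A * Q ^ (1 / 8 : ℝ) :=
    hA S hprimeS
  have h6 := powers_le_rpow hQ0 hQR hP₂0 (hP₂x.trans hPxR) hκ0 hσ0 τ₁
  -- final assembly
  have hSg0 : 0 ≤ Sg := Finset.sum_nonneg fun p hp => mul_nonneg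
    (Real.rpow_nonneg (Nat.cast_nonneg p) σ)
    (Real.log_nonneg (by exact_mod_cast (hprimeT p hp).one_lt.le))
  have hmain : K * L ^ n * (n : ℝ) ^ (κ * n) * Θ * (W₃ + Real.log R) ^ N * Sg ≤
      K * L ^ n * (Real.exp κ ^ n * Q ^ κ) * (4 ^ n * Q ^ (1 / 4 : ℝ)) *
        ((2 ^ τ₀ * W ^ τ₀) * ((((τ₁ : ℝ) + 1) / δ) ^ (τ₁ * n) * Q ^ τ₁ * Y₃ ^ δ) *
          ((8 * ((τ₀ : ℝ) + 1)) ^ τ₀ * (2 * R ^ (1 / 8 : ℝ))) * (Real.exp 1 * Q * R) ^ τ₁) *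
        (8 * (P₂ ^ σ * P₂ ^ (1 / 8 : ℝ))) := by
    have hKL : 0 ≤ K * L ^ n := mul_nonneg hK (pow_nonneg hL0 n)
    apply mul_le_mul _ h3 hSg0 (by positivity)
    apply mul_le_mul _ h4 (pow_nonneg (by linarith) N) (by positivity)
    apply mul_le_mul _ h2 hΘ0 (by positivity)
    exact mul_le_mul_of_nonneg_left h1 hKL
  have hC : (4 * L * Real.exp κ * (((τ₁ : ℝ) + 1) / δ) ^ τ₁) ^ n =
      L ^ n * Real.exp κ ^ n * 4 ^ n * (((τ₁ : ℝ) + 1) / δ) ^ (τ₁ * n) := by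
    rw [mul_pow, mul_pow, mul_pow, ← pow_mul]; ring
  have hY0 : 0 ≤ Y₃ ^ δ := Real.rpow_nonneg hY₃0.le δ
  have hWτ : 0 ≤ W ^ τ₀ := pow_nonneg hW0 τ₀
  have hrest : 0 ≤ Q ^ κ * Q ^ (1 / 4 : ℝ) * Q ^ (1 / 8 : ℝ) * Q ^ τ₁ * R ^ (1 / 8 : ℝ) * Q ^ τ₁ *
      R ^ τ₁ * (P₂ ^ σ * P₂ ^ (1 / 8 : ℝ)) := by positivity
  calc ∑ p ∈ T, (x.factorization p : ℝ) * Real.log p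
      ≤ K * L ^ n * (n : ℝ) ^ (κ * n) * Θ * (W₃ + Real.log R) ^ N * Sg := hsum'
    _ ≤ _ := hmain
    _ = 16 * K * Real.exp 1 ^ τ₁ * (16 * ((τ₀ : ℝ) + 1)) ^ τ₀ *
          ((4 * L * Real.exp κ * (((τ₁ : ℝ) + 1) / δ) ^ τ₁) ^ n) *
          (Q ^ κ * Q ^ (1 / 4 : ℝ) * Q ^ τ₁ * R ^ (1 / 8 : ℝ) * Q ^ τ₁ * R ^ τ₁ *
            (P₂ ^ σ * P₂ ^ (1 / 8 : ℝ))) * Y₃ ^ δ * W ^ τ₀ := by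
        rw [hC, show (16 : ℝ) * ((τ₀ : ℝ) + 1) = 2 * (8 * ((τ₀ : ℝ) + 1)) by ring, mul_pow 2,
          mul_pow (Real.exp 1 * Q) R, mul_pow (Real.exp 1) Q]
        ring
    _ ≤ 16 * K * Real.exp 1 ^ τ₁ * (16 * ((τ₀ : ℝ) + 1)) ^ τ₀ *
          (A * Q ^ (1 / 8 : ℝ)) *
          (Q ^ κ * Q ^ (1 / 4 : ℝ) * Q ^ τ₁ * R ^ (1 / 8 : ℝ) * Q ^ τ₁ * R ^ τ₁ *
            (P₂ ^ σ * P₂ ^ (1 / 8 : ℝ))) * Y₃ ^ δ * W ^ τ₀ := by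
        have h0 : 0 ≤ 16 * K * Real.exp 1 ^ τ₁ * (16 * ((τ₀ : ℝ) + 1)) ^ τ₀ := by positivity
        have hrest' : 0 ≤ (Q ^ κ * Q ^ (1 / 4 : ℝ) * Q ^ τ₁ * R ^ (1 / 8 : ℝ) * Q ^ τ₁ * R ^ τ₁ *
            (P₂ ^ σ * P₂ ^ (1 / 8 : ℝ))) := by positivity
        apply mul_le_mul_of_nonneg_right _ hWτ
        apply mul_le_mul_of_nonneg_right _ hY0
        apply mul_le_mul_of_nonneg_right _ hrest'
        exact mul_le_mul_of_nonneg_left h5 h0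
    _ = 16 * K * A * Real.exp 1 ^ τ₁ * (16 * ((τ₀ : ℝ) + 1)) ^ τ₀ *
          (Q ^ κ * Q ^ (1 / 4 : ℝ) * Q ^ (1 / 8 : ℝ) * Q ^ τ₁ * R ^ (1 / 8 : ℝ) * Q ^ τ₁ * R ^ τ₁ *
            (P₂ ^ σ * P₂ ^ (1 / 8 : ℝ))) * Y₃ ^ δ * W ^ τ₀ := by ring
    _ ≤ 16 * K * A * Real.exp 1 ^ τ₁ * (16 * ((τ₀ : ℝ) + 1)) ^ τ₀ *
          R ^ (κ + σ + 3 * τ₁ + 5 / 8 : ℝ) * Y₃ ^ δ * W ^ τ₀ := by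
        have h0 : 0 ≤ 16 * K * A * Real.exp 1 ^ τ₁ * (16 * ((τ₀ : ℝ) + 1)) ^ τ₀ := by positivity
        apply mul_le_mul_of_nonneg_right _ hWτ
        apply mul_le_mul_of_nonneg_right _ hY0
        exact mul_le_mul_of_nonneg_left h6 h0
    _ ≤ 48 * K * A * Real.exp τ₁ * (16 * ((τ₀ : ℝ) + 1)) ^ τ₀ *
          R ^ (κ + σ + 3 * τ₁ + 5 / 8 : ℝ) * Y₃ ^ δ * W ^ τ₀ := by
        have hRμ : 0 ≤ R ^ (κ + σ + 3 * τ₁ + 5 / 8 : ℝ) := Real.rpow_nonneg hR0.le _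
        apply mul_le_mul_of_nonneg_right _ hWτ
        apply mul_le_mul_of_nonneg_right _ hY0
        apply mul_le_mul_of_nonneg_right _ hRμ
        rw [Real.exp_one_pow]
        have : 0 ≤ K * A * Real.exp τ₁ * (16 * ((τ₀ : ℝ) + 1)) ^ τ₀ := by positivity
        linarith

end Summit.ABC.StewartYu

end
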